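import Summits.QuantumFields.BalabanUV.T4Continuum.Support.ShellMeasureLinearizedRealStructure
import Summits.QuantumFields.BalabanUV.T4Continuum.Support.ShellMeasureLandauFixedPoint
import Summits.QuantumFields.BalabanUV.Beta.LinearizingChange267FromQ

/-!
# `T4Continuum.ShellMeasureLinearizedFromQ` — (LR)_j: THE REAL-FORM LINEARIZING CHART DATA FROM `Q̃` ALONE.  Every
# ANALYTIC binder of the curved-fibre-chart ENDs' real chart data (`ShellMeasureLinearizedRealForm.realForm_chartData`,
# `ShellMeasureLinearizedRealStructure.realForm_chartData_fixed`: the quadratic-analytic non-linear part `C̃`, its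
# constant `C₂` and analyticity, the solution `D̃` of print's fixed-point equation, the reality of `LQ̃` and of `C̃`)
# is DERIVED from four hypotheses on an abstract average-in-the-chart `Q̃`: analytic on `ball 0 R`, `Q̃(0) = 0`,
# `‖Q̃‖ ≤ M_Q` there, conjugation-EQUIVARIANT — plus a bounded equivariant right inverse `h` of `LQ̃ := DQ̃(0)`
(cell `pub-balaban`, sub-cell `t4`, spine estimate NE7c (node U5b); NE7c ROUND-2 crew `t4-ne7c-formalise-*`, seat
`b2b-balaban-t4-ne7c-formalise-leaf-08` gen 10; owner table `t4/b2b-balaban-t4-ne7c-p1/LEAVES-NE7c-P1.md` v2.0 ROW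
S46 «(LR)_j CHART DATA FROM Q̃ ALONE» — WALL §3 W-d, its ANALYTIC half, cut by the owner gen 28; imports
leaf-09-g8's `ShellMeasureLinearizedRealStructure` (p217266; hence leaf-02-g5's `ShellMeasureLinearizedRealForm`
p216819, `B12JacobianReal267`, `B12Lineariz267`, `B12LinearizAnalytic267`, `B13Contraction113`), leaf-02-g2's
`ShellMeasureLandauFixedPoint` (p210318, `quadAnalytic_of_frechet`) and row D4's
`Beta.LinearizingChange267FromQ` (`nonlin`, `Mq`, `nonlin_sq_bound`, `analyticOnNhd_nonlin`) ONLY, all BY NAME;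
[folklore] calculus; 0 `def`, 0 `def … : Prop`, 0 sorry, 0 citations — the page numbers below LOCATE displayed shapes)

HONEST FRAMING.  Finite four-torus programme, rung (B)+1 only — NOT infinite volume, NOT a mass gap, NOT the Clay
problem, NOT summit progress; (B), `BetaPertHyp`, (B^μ) not consumed.  NE7c (`T4IndicatorShell.ShellWeightBound`) is
NOT PRINTED and NOT PROVED; «NE7c ⇐ the named binders».  Nothing of [Balaban 1983–89] is asserted.  This file is an
ABSTRACT JUNCTION: it discharges NO binder of the wall by itself.  It replaces the B12 leaves' hypothesis-style
analytic data (`Ct`, `C₂`, `QuadAnalytic Ct C₂ R`, `AnalyticOnNhd ℂ Ct`, `Dt` with `hDball`/`hDfix`, `hCt`) by FOUR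
HYPOTHESES ON ONE MAP `Qt : 𝒴 → 𝒳` — (Q1) `AnalyticOnNhd ℂ Qt (ball 0 R)`, `0 < R`; (Q2) `Qt 0 = 0`; (Q3)
`‖Qt B‖ ≤ M_Q` on the ball; (Q4) `Qt (κ_𝒴 B) = κ_𝒳 (Qt B)` on the ball (⋆-equivariance = reality) — and the right
inverse `hop` of `LQ̃ := fderiv ℂ Qt 0` («LQ̃h = I», [Balaban1987RG1] p. 267) with `‖hop X‖ ≤ b‖X‖` and
`hop ∘ κ_𝒳 = κ_𝒴 ∘ hop`.  For the PRINTED block average (2.4) ∕ [Balaban1985Averaging] (15)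
(`B12AverageCorridor267.Qtilde`) the four hypotheses are rows S47 (Q4), S49 (Q1)–(Q3) and S48 (`hop`) of the owner's
table — NOT this file.  What then remains of W-d is the [dict] identification of a live slot's fibre with the fibre
of that average about the step's background (node O).  NOTHING in the countdown moves; NE7c NOT PROVED; spine PROVED
0/9.  HONEST DEPENDENCY (cell): continuum YM on T⁴ ⇐ BetaPertH ∧ nine spine estimates (0/9 proved); BetaPertH ⇐ (D1)
∧ (D4) ∧ CAP+tail; G-an2-4 gates asym, D1 and NE2/3/4.

THE POINT.  Print (p. 267): «we make a change of variables linearizing the function Q̃(B′) … LQ̃B′ + C̃(B′) = LQ̃B −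
D̃(B) + C̃(B − hD̃(B)) = LQ̃B».  The tree types `LQ̃`, `C̃`, `D̃`, `h` SEPARATELY and hypothesis-style
(`B12Lineariz267` … `B12JacobianReal267`), and the curved-fibre-chart ENDs of the (LR)_j road of record
(`ShellMeasureLinearizedChart` §3–§4 ← `…Constraint` §2 ← `…RealForm` §4 ← `…RealStructure` §2) consume exactly that
binder list.  Row D4's `Beta.LinearizingChange267FromQ` showed, for the β-function cell, that `C̃ := Q̃ − DQ̃(0)`
(`nonlin Qt`) INHERITS the quadratic onset `‖C̃x‖ ≤ (2M_Q∕R²)‖x‖²` (`nonlin_sq_bound`, Schwarz-type, from (Q1)–(Q3))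
and analyticity.  HERE, for the T⁴ cell's (LR)_j road:
* §1 `C̃` FROM `Q̃`: `QuadAnalytic (nonlin Qt) (Mq R M_Q) R` (`quadAnalytic_nonlin_of_Q` —
  `ShellMeasureLandauFixedPoint.quadAnalytic_of_frechet` on `nonlin_sq_bound` + `analyticOnNhd_nonlin`), analytic on
  `{‖Y‖ < R}`, `0 ≤ Mq R M_Q`.
* §2 REALITY FROM EQUIVARIANCE: differentiating (Q4) at `0` over `ℝ` (`HasFDerivAt.restrictScalars`, the
  conjugations as the real CLMs `ShellMeasureLinearizedRealStructure.conjR`, uniqueness of the real Fréchet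
  derivative, local congruence near `0`) gives `LQ̃ (κ_𝒴 B) = κ_𝒳 (LQ̃ B)` for EVERY `B`
  (`fderiv_zero_conj_of_eventually_equivariant` — generic: differentiable at `0` + equivariant near `0`;
  `fderiv_zero_conj_of_equivariant` — the (Q1)+(Q4) form), hence `C̃ (κ_𝒴 Y) = κ_𝒳 (C̃ Y)` on the ball (`nonlin_conj_of_equivariant`) —
  the binder `hCt` of `B12JacobianReal267`.
* §3 `D̃` FROM `Q̃`: for any window radius `ε` with `9·(Mq R M_Q)·b·ε < 1`, `3ε ≤ R` there is `D̃` on `‖B‖ < ε`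
  valued in the closed ball `4·(Mq R M_Q)·ε²` with `C̃(B − hop (D̃ B)) = D̃ B` (`exists_Dt_of_Q` —
  `B12Lineariz267.exists_Dt` BY NAME), and then `Q̃(B − hop (D̃ B)) = LQ̃ B` (`Qt_substitution_eq_LQ`).
* §4 THE JUNCTION **`realForm_chartData_of_Q`** = `ShellMeasureLinearizedRealStructure.realForm_chartData_fixed`
  with `LQ := fderiv ℂ Qt 0`, `Ct := nonlin Qt`, `C₂ := Mq R M_Q` and the binders `hC`, `hCa`, `hC₂`, `hCt` ALL
  DISCHARGED from (Q1)–(Q4): on the constructed real form `E := Fix(κ_𝒴)`, `F := Fix(κ_𝒳)` the real chart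
  `B ↦ B − h (D̃_ℝ B)` is MEASURABLE, INJECTIVE on the real window `{y : Fix κ_𝒴 ∣ ‖y‖ < ε}`, DIFFERENTIABLE within
  it, and LINEARIZES the real average — conclusion LITERALLY S40's four clauses; `exists_realForm_chartData_of_Q`
  packages §3's `D̃`; `realForm_chartData_of_Q'` is the same over a hypothesis-style real form (S36's shape).
* §5 NON-VACUITY of the hypothesis set (Q1)–(Q4) + `hop`: the linear model `𝒴 = 𝒳 = ℂ`, `Qt = id`, `κ = conj`.
WHICH END ∕ BINDER: feeds `ShellMeasureLinearizedRealStructure` §2 → `…RealForm` §4 → `…Constraint` §2 →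
`…Chart` §3–§4 (row S33, the (LR)_j reading of record, RULING T-NE7c-8); REMOVES the separate analytic binders
`hC`/`hCa`/`hC₂`/`hCt`/(`hDball`,`hDfix` up to choice) from that road in favour of (Q1)–(Q4) on ONE map; mints nothing
(trigger c2).  NOTHING in the countdown moves.
-/

noncomputable section

open Set Metric Filter Topology

namespace Summit.QuantumFields.BalabanUV.T4Continuum.ShellMeasureLinearizedFromQ

open Literature.MathematicalPhysics.QuantumFieldTheory.Balaban1983to89
open B13Contraction113 (QuadAnalytic)
open B12Lineariz267 (exists_Dt linearizes)
open Summit.QuantumFields.BalabanUV.Beta.LinearizingChange267FromQ (nonlin Mq nonlin_sq_bound analyticOnNhd_nonlin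
  MQ_nonneg apply_eq_lin_add_nonlin)
open ShellMeasureLandauFixedPoint (quadAnalytic_of_frechet)
open ShellMeasureLinearizedRealStructure (conjR conjR_apply realSub incl reP realForm_chartData_fixed incl_reP_of_fixed
  conj_incl reP_incl)
open ShellMeasureLinearizedRealForm (realForm_chartData)

variable {𝒳 𝒴 : Type*} [NormedAddCommGroup 𝒳] [NormedSpace ℂ 𝒳] [NormedAddCommGroup 𝒴] [NormedSpace ℂ 𝒴]
  {Qt : 𝒴 → 𝒳} {R MQ b ε : ℝ} {hop : 𝒳 →ₗ[ℂ] 𝒴} {κX : 𝒳 ≃ₗᵢ⋆[ℂ] 𝒳} {κY : 𝒴 ≃ₗᵢ⋆[ℂ] 𝒴}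

/-! ## §1 The non-linear part `C̃ := Q̃ − LQ̃` from `Q̃`: quadratic-analytic with `C₂ = 2M_Q∕R²` -/

omit [NormedSpace ℂ 𝒴] in
/-- the two spellings of the analyticity domain used by the B12 leaves (`{Y | ‖Y‖ < R}`) and by row D4 (`ball 0 R`)
agree. [folklore] -/
theorem setOf_norm_lt_eq_ball (R : ℝ) : {Y : 𝒴 | ‖Y‖ < R} = ball (0 : 𝒴) R :=
  Set.ext fun _ => by rw [mem_setOf_eq, mem_ball_zero_iff]

omit [NormedSpace ℂ 𝒳] [NormedSpace ℂ 𝒴] in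
/-- `0 ≤ C₂ = Mq R M_Q` — the sup bound at the centre makes `M_Q ≥ 0`. [folklore] -/
theorem Mq_nonneg_of_Q (hR : 0 < R) (hQM : ∀ B ∈ ball (0 : 𝒴) R, ‖Qt B‖ ≤ MQ) : 0 ≤ Mq R MQ := by
  have := MQ_nonneg hR hQM
  unfold Mq
  positivity

/-- **`C̃` FROM `Q̃` IS QUADRATIC-ANALYTIC** (B13's `QuadAnalytic (nonlin Qt) (Mq R M_Q) R`): the quadratic onset is row
D4's `nonlin_sq_bound` (from (Q1)–(Q3)), the line-analyticity is `ShellMeasureLandauFixedPoint.quadAnalytic_of_frechet`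
on `analyticOnNhd_nonlin`. [folklore] -/
theorem quadAnalytic_nonlin_of_Q [CompleteSpace 𝒳] (hR : 0 < R) (hQa : AnalyticOnNhd ℂ Qt (ball 0 R))
    (hQM : ∀ B ∈ ball (0 : 𝒴) R, ‖Qt B‖ ≤ MQ) (hQ0 : Qt 0 = 0) :
    QuadAnalytic (nonlin Qt) (Mq R MQ) R :=
  quadAnalytic_of_frechet
    (fun Z hZ => by
      simpa only [Mq] using nonlin_sq_bound hR hQa.differentiableOn hQM hQ0 Z (mem_ball_zero_iff.2 hZ))
    (analyticOnNhd_nonlin hQa).differentiableOn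

/-- `C̃` is analytic on `{‖Y‖ < R}` (the B12 leaves' spelling of the domain). [folklore] -/
theorem analyticOnNhd_nonlin_of_Q (hQa : AnalyticOnNhd ℂ Qt (ball 0 R)) :
    AnalyticOnNhd ℂ (nonlin Qt) {Y : 𝒴 | ‖Y‖ < R} := by
  rw [setOf_norm_lt_eq_ball]
  exact analyticOnNhd_nonlin hQa

/-! ## §2 Reality of `LQ̃` and of `C̃` from the ⋆-equivariance of `Q̃` -/

/-- (Q1) ⟹ `Q̃` has the Fréchet derivative `LQ̃ := fderiv ℂ Qt 0` at `0`. [folklore] -/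
theorem hasFDerivAt_Qt_zero (hR : 0 < R) (hQa : AnalyticOnNhd ℂ Qt (ball 0 R)) :
    HasFDerivAt Qt (fderiv ℂ Qt 0) 0 :=
  (hQa 0 (mem_ball_self hR)).differentiableAt.hasFDerivAt

/-- **THE FRÉCHET DERIVATIVE AT `0` OF A CONJUGATION-EQUIVARIANT MAP IS EQUIVARIANT** (generic form: `Qt`
complex-differentiable at `0`, `Q̃ ∘ κ_𝒴 = κ_𝒳 ∘ Q̃` near `0`): `DQ̃(0) (κ_𝒴 B) = κ_𝒳 (DQ̃(0) B)` for EVERY `B` —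
differentiate both sides at `0` as REAL maps (`κ` real-linear: `ShellMeasureLinearizedRealStructure.conjR`;
`HasFDerivAt.restrictScalars ℝ`; the two composites agree near `0`, so their real derivatives coincide; the pattern of
`B12JacobianReal267.fderiv_Dt_conj` at the point `0`, where no reality hypothesis on the point is needed). [folklore] -/
theorem fderiv_zero_conj_of_eventually_equivariant (hQd : DifferentiableAt ℂ Qt 0)
    (hQt : ∀ᶠ B in 𝓝 (0 : 𝒴), Qt (κY B) = κX (Qt B)) (B : 𝒴) :
    fderiv ℂ Qt 0 (κY B) = κX (fderiv ℂ Qt 0 B) := by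
  have h0 : HasFDerivAt Qt ((fderiv ℂ Qt 0).restrictScalars ℝ) 0 := hQd.hasFDerivAt.restrictScalars ℝ
  have h0' : HasFDerivAt Qt ((fderiv ℂ Qt 0).restrictScalars ℝ) (conjR κY 0) := by rwa [map_zero]
  have h1 : HasFDerivAt (Qt ∘ conjR κY) (((fderiv ℂ Qt 0).restrictScalars ℝ).comp (conjR κY)) 0 :=
    h0'.comp 0 (conjR κY).hasFDerivAt
  have h2 : HasFDerivAt (conjR κX ∘ Qt) ((conjR κX).comp ((fderiv ℂ Qt 0).restrictScalars ℝ)) 0 :=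
    (conjR κX).hasFDerivAt.comp 0 h0
  have heq : (Qt ∘ conjR κY) =ᶠ[𝓝 (0 : 𝒴)] (conjR κX ∘ Qt) := by
    filter_upwards [hQt] with Y hY
    simp only [Function.comp_apply, conjR_apply]
    exact hY
  have h3 := h1.unique (h2.congr_of_eventuallyEq heq)
  have h4 := congrArg (fun T : 𝒴 →L[ℝ] 𝒳 => T B) h3
  simpa only [ContinuousLinearMap.coe_comp, Function.comp_apply, ContinuousLinearMap.coe_restrictScalars',
    conjR_apply] using h4

/-- **REALITY OF `LQ̃` FROM (Q1) + (Q4)**: if `Q̃ ∘ κ_𝒴 = κ_𝒳 ∘ Q̃` on `ball 0 R` and `Q̃` is analytic there then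
`LQ̃ (κ_𝒴 B) = κ_𝒳 (LQ̃ B)` for EVERY `B` (`LQ̃ := fderiv ℂ Qt 0`). [folklore] -/
theorem fderiv_zero_conj_of_equivariant (hR : 0 < R) (hQa : AnalyticOnNhd ℂ Qt (ball 0 R))
    (hQt : ∀ B ∈ ball (0 : 𝒴) R, Qt (κY B) = κX (Qt B)) (B : 𝒴) :
    fderiv ℂ Qt 0 (κY B) = κX (fderiv ℂ Qt 0 B) :=
  fderiv_zero_conj_of_eventually_equivariant (hQa 0 (mem_ball_self hR)).differentiableAt
    (by filter_upwards [ball_mem_nhds (0 : 𝒴) hR] with Y hY using hQt Y hY) B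

/-- **REALITY OF `C̃` FROM EQUIVARIANCE** — the binder `hCt` of `B12JacobianReal267`: `C̃ (κ_𝒴 Y) = κ_𝒳 (C̃ Y)` for
`‖Y‖ < R`. [folklore] -/
theorem nonlin_conj_of_equivariant (hR : 0 < R) (hQa : AnalyticOnNhd ℂ Qt (ball 0 R))
    (hQt : ∀ B ∈ ball (0 : 𝒴) R, Qt (κY B) = κX (Qt B)) :
    ∀ Y : 𝒴, ‖Y‖ < R → nonlin Qt (κY Y) = κX (nonlin Qt Y) := by
  intro Y hY
  simp only [nonlin]
  rw [hQt Y (mem_ball_zero_iff.2 hY), fderiv_zero_conj_of_equivariant hR hQa hQt Y, map_sub]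

/-- the real part of an equivariant `hop` — recorded for the consumer (`ShellMeasureLinearizedRealForm.hop_real`).
[folklore] -/
theorem fderiv_zero_real_of_equivariant (hR : 0 < R) (hQa : AnalyticOnNhd ℂ Qt (ball 0 R))
    (hQt : ∀ B ∈ ball (0 : 𝒴) R, Qt (κY B) = κX (Qt B)) {B : 𝒴} (hB : κY B = B) :
    κX (fderiv ℂ Qt 0 B) = fderiv ℂ Qt 0 B := by
  rw [← fderiv_zero_conj_of_equivariant hR hQa hQt B, hB]

/-! ## §3 `D̃` from `Q̃`: print's fixed-point equation for `C̃ := nonlin Qt` -/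

section FixedPoint

variable [CompleteSpace 𝒳]

/-- **`D̃` FROM `Q̃`** («there exists exactly one solution of this equation», p. 267): for a window radius `ε` with
`9·C₂·b·ε < 1`, `3ε ≤ R` (`C₂ = Mq R M_Q`) there is `D̃ : 𝒴 → 𝒳` with, for `‖B‖ < ε`, `D̃ B` in the closed ball
`4C₂ε²` and `C̃(B − hop (D̃ B)) = D̃ B` — `B12Lineariz267.exists_Dt` with `hC`, `hC₂` DISCHARGED by §1. [folklore] -/
theorem exists_Dt_of_Q (hR : 0 < R) (hQa : AnalyticOnNhd ℂ Qt (ball 0 R))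
    (hQM : ∀ B ∈ ball (0 : 𝒴) R, ‖Qt B‖ ≤ MQ) (hQ0 : Qt 0 = 0) (hb : 0 ≤ b) (hHop : ∀ X, ‖hop X‖ ≤ b * ‖X‖)
    (hq : 9 * Mq R MQ * b * ε < 1) (hRC : 3 * ε ≤ R) :
    ∃ Dt : 𝒴 → 𝒳, ∀ B : 𝒴, ‖B‖ < ε →
      Dt B ∈ closedBall (0 : 𝒳) (4 * Mq R MQ * ε ^ 2) ∧ nonlin Qt (B - hop (Dt B)) = Dt B :=
  exists_Dt (quadAnalytic_nonlin_of_Q hR hQa hQM hQ0) (Mq_nonneg_of_Q hR hQM) hb hHop hq hRC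

omit [CompleteSpace 𝒳] in
/-- **THE SUBSTITUTION LINEARIZES `Q̃` ITSELF**: with `LQ̃ := fderiv ℂ Qt 0` and «LQ̃h = I», any solution of
`C̃(B − hop D) = D` gives `Q̃(B − hop D) = LQ̃ B` (`B12Lineariz267.linearizes` + `Q̃ = LQ̃ + C̃`). [folklore] -/
theorem Qt_substitution_eq_LQ (hLQh : ∀ X, fderiv ℂ Qt 0 (hop X) = X) {B : 𝒴} {D : 𝒳}
    (hfix : nonlin Qt (B - hop D) = D) : Qt (B - hop D) = fderiv ℂ Qt 0 B := by
  rw [apply_eq_lin_add_nonlin Qt (B - hop D)]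
  have h := linearizes (LQ := ((fderiv ℂ Qt 0 : 𝒴 →L[ℂ] 𝒳) : 𝒴 →ₗ[ℂ] 𝒳)) (hop := hop) (Ct := nonlin Qt)
    (fun X => hLQh X) hfix
  simpa only [ContinuousLinearMap.coe_coe] using h

end FixedPoint

/-! ## §4 The junction: the curved-fibre-chart ENDs' real chart data from (Q1)–(Q4) + `hop` -/

section Junction

variable [CompleteSpace 𝒳] [CompleteSpace 𝒴]

/-- **THE REAL-FORM LINEARIZING CHART DATA FROM `Q̃` ALONE — REAL FORM CONSTRUCTED (S40's shape).**  Data: (Q1)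
`AnalyticOnNhd ℂ Qt (ball 0 R)`, `0 < R`; (Q2) `Qt 0 = 0`; (Q3) `‖Qt B‖ ≤ M_Q` on the ball; (Q4) `Qt (κ_𝒴 B) = κ_𝒳 (Qt B)`
on the ball, for INVOLUTIVE conjugations `κ_𝒳`, `κ_𝒴`; the right inverse `hop` of `LQ̃ := fderiv ℂ Qt 0` («LQ̃h = I»)
with `‖hop X‖ ≤ b‖X‖`, `hop ∘ κ_𝒳 = κ_𝒴 ∘ hop`; a window radius `ε` with `9·(Mq R M_Q)·b·ε < 1`, `3ε ≤ R`; a solution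
`D̃` of `C̃(B − hop (D̃ B)) = D̃ B` in the ball `4·(Mq R M_Q)·ε²` on `‖B‖ < ε` (§3 `exists_Dt_of_Q` supplies one); a
splitting `Ψ`.  CONCLUSION — LITERALLY `ShellMeasureLinearizedRealStructure.realForm_chartData_fixed`'s four clauses
with `LQ := fderiv ℂ Qt 0`, `Ct := nonlin Qt`: on `E := Fix(κ_𝒴)` the real chart `B ↦ B − h (D̃_ℝ B)`
(`h := reP κ_𝒴 ∘ hop ∘ incl κ_𝒳`, `D̃_ℝ := 1_O · reP κ_𝒳 ∘ D̃ ∘ incl κ_𝒴`, `O := {‖incl κ_𝒴 ·‖ < ε}`) is (i) MEASURABLE,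
(ii) INJECTIVE on `O`, (iii) has the derivative `id − h ∘ (reP κ_𝒳 ∘ DD̃(ι B)↾ℝ ∘ incl κ_𝒴)` within `O`, (iv) LINEARIZES
the real average `L + C̃_ℝ` into the second coordinate of `Ψ`.  The binders `hC`, `hCa`, `hC₂`, `hCt` of the B12
leaves are DISCHARGED by §1–§2; nothing printed is asserted. [folklore] -/
theorem realForm_chartData_of_Q [MeasurableSpace 𝒴] [BorelSpace 𝒴] [FiniteDimensional ℂ 𝒴] [MeasurableSpace 𝒳]
    [BorelSpace 𝒳] (hκX : ∀ X, κX (κX X) = X) (hκY : ∀ B, κY (κY B) = B)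
    (hR : 0 < R) (hQa : AnalyticOnNhd ℂ Qt (ball 0 R)) (hQ0 : Qt 0 = 0)
    (hQM : ∀ B ∈ ball (0 : 𝒴) R, ‖Qt B‖ ≤ MQ) (hQt : ∀ B ∈ ball (0 : 𝒴) R, Qt (κY B) = κX (Qt B))
    (hLQh : ∀ X, fderiv ℂ Qt 0 (hop X) = X) (hb : 0 ≤ b) (hHop : ∀ X, ‖hop X‖ ≤ b * ‖X‖)
    (hhop : ∀ X, hop (κX X) = κY (hop X)) (hq : 9 * Mq R MQ * b * ε < 1) (hRC : 3 * ε ≤ R)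
    {Dt : 𝒴 → 𝒳} (hDball : ∀ B : 𝒴, ‖B‖ < ε → Dt B ∈ closedBall (0 : 𝒳) (4 * Mq R MQ * ε ^ 2))
    (hDfix : ∀ B : 𝒴, ‖B‖ < ε → nonlin Qt (B - hop (Dt B)) = Dt B)
    {Kf : Type*} [NormedAddCommGroup Kf] [NormedSpace ℝ Kf] (Ψ : (Kf × realSub κX) ≃L[ℝ] realSub κY)
    (hΨ : ∀ y, (Ψ.symm y).2 = (reP κX hκX ∘L (fderiv ℂ Qt 0).restrictScalars ℝ ∘L incl κY) y) :
    Measurable (fun B : realSub κY => B - (reP κY hκY ∘L (hop.mkContinuous b hHop).restrictScalars ℝ ∘L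
        incl κX) (({y : realSub κY | ‖incl κY y‖ < ε}).piecewise
          (fun y => reP κX hκX (Dt (incl κY y))) 0 B)) ∧
      InjOn (fun B : realSub κY => B - (reP κY hκY ∘L (hop.mkContinuous b hHop).restrictScalars ℝ ∘L
        incl κX) (({y : realSub κY | ‖incl κY y‖ < ε}).piecewise
          (fun y => reP κX hκX (Dt (incl κY y))) 0 B))
        {y : realSub κY | ‖incl κY y‖ < ε} ∧
      (∀ B ∈ {y : realSub κY | ‖incl κY y‖ < ε}, HasFDerivWithinAt
        (fun B : realSub κY => B - (reP κY hκY ∘L (hop.mkContinuous b hHop).restrictScalars ℝ ∘L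
          incl κX) (({y : realSub κY | ‖incl κY y‖ < ε}).piecewise
            (fun y => reP κX hκX (Dt (incl κY y))) 0 B))
        (ContinuousLinearMap.id ℝ (realSub κY) - (reP κY hκY ∘L (hop.mkContinuous b hHop).restrictScalars ℝ ∘L
          incl κX).comp (reP κX hκX ∘L (fderiv ℂ Dt (incl κY B)).restrictScalars ℝ ∘L
            incl κY)) {y : realSub κY | ‖incl κY y‖ < ε} B) ∧
      ∀ B ∈ {y : realSub κY | ‖incl κY y‖ < ε},
        (reP κX hκX ∘L (fderiv ℂ Qt 0).restrictScalars ℝ ∘L incl κY) (B - (reP κY hκY ∘L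
            (hop.mkContinuous b hHop).restrictScalars ℝ ∘L incl κX)
            (({y : realSub κY | ‖incl κY y‖ < ε}).piecewise
              (fun y => reP κX hκX (Dt (incl κY y))) 0 B)) +
          (fun y => reP κX hκX (nonlin Qt (incl κY y))) (B - (reP κY hκY ∘L
            (hop.mkContinuous b hHop).restrictScalars ℝ ∘L incl κX)
            (({y : realSub κY | ‖incl κY y‖ < ε}).piecewise
              (fun y => reP κX hκX (Dt (incl κY y))) 0 B)) = (Ψ.symm B).2 :=
  realForm_chartData_fixed hκX hκY (fderiv ℂ Qt 0) hLQh (quadAnalytic_nonlin_of_Q hR hQa hQM hQ0)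
    (analyticOnNhd_nonlin_of_Q hQa) (Mq_nonneg_of_Q hR hQM) hb hHop hq hRC hDball hDfix hhop
    (nonlin_conj_of_equivariant hR hQa hQt) Ψ hΨ

/-- **THE SAME WITH `D̃` SUPPLIED** — only (Q1)–(Q4), `hop` and the splitting remain: there is `D̃` (in the ball
`4·(Mq R M_Q)·ε²`, solving print's fixed-point equation on `‖B‖ < ε`, and LINEARIZING `Q̃`: `Q̃(B − hop (D̃ B)) = LQ̃ B`)
whose real chart has the four properties of `realForm_chartData_of_Q`. [folklore] -/
theorem exists_realForm_chartData_of_Q [MeasurableSpace 𝒴] [BorelSpace 𝒴] [FiniteDimensional ℂ 𝒴]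
    [MeasurableSpace 𝒳] [BorelSpace 𝒳] (hκX : ∀ X, κX (κX X) = X) (hκY : ∀ B, κY (κY B) = B)
    (hR : 0 < R) (hQa : AnalyticOnNhd ℂ Qt (ball 0 R)) (hQ0 : Qt 0 = 0)
    (hQM : ∀ B ∈ ball (0 : 𝒴) R, ‖Qt B‖ ≤ MQ) (hQt : ∀ B ∈ ball (0 : 𝒴) R, Qt (κY B) = κX (Qt B))
    (hLQh : ∀ X, fderiv ℂ Qt 0 (hop X) = X) (hb : 0 ≤ b) (hHop : ∀ X, ‖hop X‖ ≤ b * ‖X‖)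
    (hhop : ∀ X, hop (κX X) = κY (hop X)) (hq : 9 * Mq R MQ * b * ε < 1) (hRC : 3 * ε ≤ R)
    {Kf : Type*} [NormedAddCommGroup Kf] [NormedSpace ℝ Kf] (Ψ : (Kf × realSub κX) ≃L[ℝ] realSub κY)
    (hΨ : ∀ y, (Ψ.symm y).2 = (reP κX hκX ∘L (fderiv ℂ Qt 0).restrictScalars ℝ ∘L incl κY) y) :
    ∃ Dt : 𝒴 → 𝒳,
      (∀ B : 𝒴, ‖B‖ < ε → Dt B ∈ closedBall (0 : 𝒳) (4 * Mq R MQ * ε ^ 2) ∧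
        nonlin Qt (B - hop (Dt B)) = Dt B ∧ Qt (B - hop (Dt B)) = fderiv ℂ Qt 0 B) ∧
      Measurable (fun B : realSub κY => B - (reP κY hκY ∘L (hop.mkContinuous b hHop).restrictScalars ℝ ∘L
          incl κX) (({y : realSub κY | ‖incl κY y‖ < ε}).piecewise
            (fun y => reP κX hκX (Dt (incl κY y))) 0 B)) ∧
      InjOn (fun B : realSub κY => B - (reP κY hκY ∘L (hop.mkContinuous b hHop).restrictScalars ℝ ∘L
          incl κX) (({y : realSub κY | ‖incl κY y‖ < ε}).piecewise
            (fun y => reP κX hκX (Dt (incl κY y))) 0 B))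
          {y : realSub κY | ‖incl κY y‖ < ε} ∧
      (∀ B ∈ {y : realSub κY | ‖incl κY y‖ < ε}, HasFDerivWithinAt
          (fun B : realSub κY => B - (reP κY hκY ∘L (hop.mkContinuous b hHop).restrictScalars ℝ ∘L
            incl κX) (({y : realSub κY | ‖incl κY y‖ < ε}).piecewise
              (fun y => reP κX hκX (Dt (incl κY y))) 0 B))
          (ContinuousLinearMap.id ℝ (realSub κY) - (reP κY hκY ∘L (hop.mkContinuous b hHop).restrictScalars ℝ ∘L
            incl κX).comp (reP κX hκX ∘L (fderiv ℂ Dt (incl κY B)).restrictScalars ℝ ∘L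
              incl κY)) {y : realSub κY | ‖incl κY y‖ < ε} B) ∧
      ∀ B ∈ {y : realSub κY | ‖incl κY y‖ < ε},
          (reP κX hκX ∘L (fderiv ℂ Qt 0).restrictScalars ℝ ∘L incl κY) (B - (reP κY hκY ∘L
              (hop.mkContinuous b hHop).restrictScalars ℝ ∘L incl κX)
              (({y : realSub κY | ‖incl κY y‖ < ε}).piecewise
                (fun y => reP κX hκX (Dt (incl κY y))) 0 B)) +
            (fun y => reP κX hκX (nonlin Qt (incl κY y))) (B - (reP κY hκY ∘L
              (hop.mkContinuous b hHop).restrictScalars ℝ ∘L incl κX)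
              (({y : realSub κY | ‖incl κY y‖ < ε}).piecewise
                (fun y => reP κX hκX (Dt (incl κY y))) 0 B)) = (Ψ.symm B).2 := by
  obtain ⟨Dt, hDt⟩ := exists_Dt_of_Q hR hQa hQM hQ0 hb hHop hq hRC
  have hDball : ∀ B : 𝒴, ‖B‖ < ε → Dt B ∈ closedBall (0 : 𝒳) (4 * Mq R MQ * ε ^ 2) := fun B hB => (hDt B hB).1
  have hDfix : ∀ B : 𝒴, ‖B‖ < ε → nonlin Qt (B - hop (Dt B)) = Dt B := fun B hB => (hDt B hB).2
  obtain ⟨h1, h2, h3, h4⟩ := realForm_chartData_of_Q hκX hκY hR hQa hQ0 hQM hQt hLQh hb hHop hhop hq hRC hDball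
    hDfix Ψ hΨ
  exact ⟨Dt, fun B hB => ⟨hDball B hB, hDfix B hB, Qt_substitution_eq_LQ hLQh (hDfix B hB)⟩, h1, h2, h3, h4⟩

/-- **THE SAME OVER A HYPOTHESIS-STYLE REAL FORM (S36's shape)**: for real normed `E`, `F` and real CLMs
`ιE : E → 𝒴`, `πE : 𝒴 → E`, `ιF`, `πF` with the five axioms of `ShellMeasureLinearizedRealForm.realForm_chartData`,
the four-clause real chart data with `LQ := fderiv ℂ Qt 0`, `Ct := nonlin Qt`, all analytic binders from (Q1)–(Q4).
[folklore] -/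
theorem realForm_chartData_of_Q' {E F : Type*} [NormedAddCommGroup E] [NormedSpace ℝ E] [NormedAddCommGroup F]
    [NormedSpace ℝ F] [MeasurableSpace E] [BorelSpace E] [FiniteDimensional ℝ E] [MeasurableSpace F] [BorelSpace F]
    {ιE : E →L[ℝ] 𝒴} {πE : 𝒴 →L[ℝ] E} {ιF : F →L[ℝ] 𝒳} {πF : 𝒳 →L[ℝ] F}
    (hκX : ∀ X, κX (κX X) = X) (hκY : ∀ B, κY (κY B) = B)
    (hR : 0 < R) (hQa : AnalyticOnNhd ℂ Qt (ball 0 R)) (hQ0 : Qt 0 = 0)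
    (hQM : ∀ B ∈ ball (0 : 𝒴) R, ‖Qt B‖ ≤ MQ) (hQt : ∀ B ∈ ball (0 : 𝒴) R, Qt (κY B) = κX (Qt B))
    (hLQh : ∀ X, fderiv ℂ Qt 0 (hop X) = X) (hb : 0 ≤ b) (hHop : ∀ X, ‖hop X‖ ≤ b * ‖X‖)
    (hhop : ∀ X, hop (κX X) = κY (hop X)) (hq : 9 * Mq R MQ * b * ε < 1) (hRC : 3 * ε ≤ R)
    {Dt : 𝒴 → 𝒳} (hDball : ∀ B : 𝒴, ‖B‖ < ε → Dt B ∈ closedBall (0 : 𝒳) (4 * Mq R MQ * ε ^ 2))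
    (hDfix : ∀ B : 𝒴, ‖B‖ < ε → nonlin Qt (B - hop (Dt B)) = Dt B)
    (hιπE : ∀ B, κY B = B → ιE (πE B) = B) (hιEr : ∀ y, κY (ιE y) = ιE y)
    (hιπF : ∀ X, κX X = X → ιF (πF X) = X) (hιFr : ∀ x, κX (ιF x) = ιF x) (hπιF : ∀ x, πF (ιF x) = x)
    {Kf : Type*} [NormedAddCommGroup Kf] [NormedSpace ℝ Kf] (Ψ : (Kf × F) ≃L[ℝ] E)
    (hΨ : ∀ y, (Ψ.symm y).2 = (πF ∘L (fderiv ℂ Qt 0).restrictScalars ℝ ∘L ιE) y) :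
    Measurable (fun B : E => B - (πE ∘L (hop.mkContinuous b hHop).restrictScalars ℝ ∘L ιF)
        (({y : E | ‖ιE y‖ < ε}).piecewise (fun y => πF (Dt (ιE y))) 0 B)) ∧
      InjOn (fun B : E => B - (πE ∘L (hop.mkContinuous b hHop).restrictScalars ℝ ∘L ιF)
        (({y : E | ‖ιE y‖ < ε}).piecewise (fun y => πF (Dt (ιE y))) 0 B)) {y : E | ‖ιE y‖ < ε} ∧
      (∀ B ∈ {y : E | ‖ιE y‖ < ε}, HasFDerivWithinAt
        (fun B : E => B - (πE ∘L (hop.mkContinuous b hHop).restrictScalars ℝ ∘L ιF)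
          (({y : E | ‖ιE y‖ < ε}).piecewise (fun y => πF (Dt (ιE y))) 0 B))
        (ContinuousLinearMap.id ℝ E - (πE ∘L (hop.mkContinuous b hHop).restrictScalars ℝ ∘L ιF).comp
          (πF ∘L (fderiv ℂ Dt (ιE B)).restrictScalars ℝ ∘L ιE)) {y : E | ‖ιE y‖ < ε} B) ∧
      ∀ B ∈ {y : E | ‖ιE y‖ < ε},
        (πF ∘L (fderiv ℂ Qt 0).restrictScalars ℝ ∘L ιE) (B - (πE ∘L (hop.mkContinuous b hHop).restrictScalars ℝ ∘L ιF)
            (({y : E | ‖ιE y‖ < ε}).piecewise (fun y => πF (Dt (ιE y))) 0 B)) +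
          (fun y => πF (nonlin Qt (ιE y))) (B - (πE ∘L (hop.mkContinuous b hHop).restrictScalars ℝ ∘L ιF)
            (({y : E | ‖ιE y‖ < ε}).piecewise (fun y => πF (Dt (ιE y))) 0 B)) = (Ψ.symm B).2 :=
  realForm_chartData (fderiv ℂ Qt 0) hLQh (quadAnalytic_nonlin_of_Q hR hQa hQM hQ0) (analyticOnNhd_nonlin_of_Q hQa)
    (Mq_nonneg_of_Q hR hQM) hb hHop hq hRC hDball hDfix hκX hκY hhop (nonlin_conj_of_equivariant hR hQa hQt)
    hιπE hιEr hιπF hιFr hπιF Ψ hΨ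

end Junction

/-! ## §5 Non-vacuity of the hypothesis set (Q1)–(Q4) + `hop` -/

/-- The hypotheses on `Q̃` and `hop` of §3–§4 are JOINTLY SATISFIABLE: the linear model `𝒴 = 𝒳 = ℂ`, `Qt = id`,
`hop = id`, `κ_𝒳 = κ_𝒴 =` complex conjugation, `R = 1`, `M_Q = 1`, `b = 1`, `ε = 1∕20` (`9·(2·1∕1²)·1·(1∕20) < 1`,
`3∕20 ≤ 1`); a TOY about the binder SHAPES only — it says nothing about Bałaban's averages (c3). [folklore] -/
example : ∃ (Qt : ℂ → ℂ) (hop : ℂ →ₗ[ℂ] ℂ) (κX κY : ℂ ≃ₗᵢ⋆[ℂ] ℂ) (R MQ b ε : ℝ),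
    0 < R ∧ AnalyticOnNhd ℂ Qt (ball 0 R) ∧ Qt 0 = 0 ∧ (∀ B ∈ ball (0 : ℂ) R, ‖Qt B‖ ≤ MQ) ∧
    (∀ B ∈ ball (0 : ℂ) R, Qt (κY B) = κX (Qt B)) ∧ (∀ X, fderiv ℂ Qt 0 (hop X) = X) ∧ 0 ≤ b ∧
    (∀ X, ‖hop X‖ ≤ b * ‖X‖) ∧ (∀ X, hop (κX X) = κY (hop X)) ∧ (∀ X, κX (κX X) = X) ∧ (∀ B, κY (κY B) = B) ∧
    9 * Mq R MQ * b * ε < 1 ∧ 3 * ε ≤ R := by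
  refine ⟨id, LinearMap.id, starₗᵢ ℂ, starₗᵢ ℂ, 1, 1, 1, 1 / 20, one_pos, fun z _ => analyticAt_id, rfl,
    fun B hB => ?_, fun B _ => rfl, fun X => ?_, zero_le_one, fun X => by simp, fun X => rfl, fun X => by simp,
    fun B => by simp, ?_, by norm_num⟩
  · exact (mem_ball_zero_iff.1 hB).le
  · rw [fderiv_id]; rfl
  · norm_num [Mq]

end Summit.QuantumFields.BalabanUV.T4Continuum.ShellMeasureLinearizedFromQ

end
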